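import Literature.Computability.QuantumComplexity.PauliExpansion
import Mathlib.Analysis.SpecialFunctions.Trigonometric.Basic
import HarnessLib

/-!
# Single-qubit rotation gates `R_x(θ)`, `R_y(θ)`, the Hadamard gate, and their Bloch-sphere action

Textbook material: R. LaPierre, *Introduction to Quantum Computing* (Springer, 2021), Ch. 14 "Precession",
§14.1 "Rotation Matrices", eqs. (14.1)–(14.6) and Exercises 14.1–14.2 (the same matrices are the rotation
operators of Nielsen–Chuang §4.2), together with Ch. 7: §7.5 eq. (7.8) (`|0⟩ = (1, 0)ᵀ`, `U|0⟩ = a|0⟩ + b|1⟩`),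
§7.7 eq. (7.24) (`⟨ψ|U|ψ⟩`, the expectation value of an operator), §7.13 eqs. (7.34)–(7.35) and Exercise 7.5
(the Hadamard gate, `H|0⟩ = |+⟩`, `H` unitary):

* (14.2) `R_x(θ) = [[cos θ/2, −i sin θ/2], [−i sin θ/2, cos θ/2]]`,
  (14.3) `R_y(θ) = [[cos θ/2, −sin θ/2], [sin θ/2, cos θ/2]]`;
* (14.5)–(14.6) `R_x(θ) = cos(θ/2)·I − i sin(θ/2)·σ_x`, `R_y(θ) = cos(θ/2)·I − i sin(θ/2)·σ_y`;
* Exercise 14.2: the rotation matrices are unitary;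
* Exercise 14.1 with the Bloch form (14.1) `|ψ⟩ = cos(θ/2)|0⟩ + e^{iφ} sin(θ/2)|1⟩`: `R_y(θ)`, `R_x(θ)` rotate the
  Bloch vector by the angle `θ` about the `y`, resp. `x`, axis.  Recorded here as the closed forms of the Pauli
  expectation values (`⟨A⟩_ψ = ⟨ψ|A|ψ⟩`) of the states met in the lane's certificates:
  `R_y(θ)|0⟩`: `⟨Z⟩ = cos θ`, `⟨X⟩ = sin θ`, `⟨Y⟩ = 0`;  `R_y(θ)H|0⟩`: `⟨Z⟩ = −sin θ`;
  `R_x(φ)R_y(θ)|0⟩`: `⟨X⟩ = sin θ`, `⟨Y⟩ = −cos θ · sin φ`, `⟨Z⟩ = cos θ · cos φ`.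

Why this file exists (lane pub-qadeq — instance-level adjudication of specific advantage claims; no claim about
BQP vs BPP or the summit): several refereed "quantum machine-learning" models adjudicated by the cell consist of ONE
simulated qubit with an `R_y–R_x` ansatz read out in the Pauli basis, or of a product of single-qubit `H`–`R_y`
wires read out in `Z` (CLAIMS rows A-1456, A-1457); the lane certificates compare a state-vector route with exactly
these closed forms, and this file is their kernel-checked version on the tree's `Bool`-indexed one-qubit matrices
(`Pauli.mat` of `PauliExpansion.lean`, `false = |0⟩`, `true = |1⟩`).

Everything is PROVED (2 × 2 matrix algebra, real and imaginary parts, the double-angle identities); no named facts.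
Mathlib / tree search: Mathlib has no qubit gates (`lean search 'rotY|hadamard|RYGate'` finds only the tree's
`SO(3)` rotation `rotY` in `Literature.AlgebraicTopology.FundamentalGroup` and the lattice isometry `rotYpi`); the
tree's one-qubit Pauli matrices are reused, nothing is re-declared.
-/

noncomputable section

open Matrix

namespace Literature.Computability.QuantumComplexity.SingleQubitRotations

open Literature.Computability.QuantumComplexity
open Literature.Computability.QuantumComplexity.Pauli

/-! ### Definitions -/

/-- The computational basis state `|0⟩ = (1, 0)ᵀ` on the index type `Bool` (`false = |0⟩`, `true = |1⟩`).
[cite: Lapierre2021, Ch. 7 §7.5 eq. (7.8)] -/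
def ket0 : Bool → ℂ := fun a => if a then 0 else 1

/-- The rotation `R_y(θ) = [[cos θ/2, −sin θ/2], [sin θ/2, cos θ/2]]` about the `y` axis (rows / columns indexed by
`Bool`, `false = |0⟩`). [cite: Lapierre2021, Ch. 14 §14.1 eq. (14.3)] -/
def rotY (θ : ℝ) : Matrix Bool Bool ℂ :=
  Matrix.of fun a b =>
    if a = b then (Real.cos (θ / 2) : ℂ) else if a then (Real.sin (θ / 2) : ℂ) else -(Real.sin (θ / 2) : ℂ)

/-- The rotation `R_x(θ) = [[cos θ/2, −i sin θ/2], [−i sin θ/2, cos θ/2]]` about the `x` axis; the off-diagonal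
entry `−i sin(θ/2)` is written as the complex number `⟨0, −sin(θ/2)⟩`. [cite: Lapierre2021, Ch. 14 §14.1 eq. (14.2)] -/
def rotX (θ : ℝ) : Matrix Bool Bool ℂ :=
  Matrix.of fun a b => if a = b then (Real.cos (θ / 2) : ℂ) else ⟨0, -Real.sin (θ / 2)⟩

/-- The Hadamard gate `H = (1/√2)·[[1, 1], [1, −1]]`. [cite: Lapierre2021, Ch. 7 §7.13 eq. (7.35)] -/
def hadamard : Matrix Bool Bool ℂ :=
  Matrix.of fun a b => if a = true ∧ b = true then -(((Real.sqrt 2)⁻¹ : ℝ) : ℂ) else (((Real.sqrt 2)⁻¹ : ℝ) : ℂ)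

/-- The expectation value `⟨ψ|A|ψ⟩ = Σ_{a,b} conj(ψ_a) A_{ab} ψ_b` of a one-qubit operator `A` in the (normalised)
state vector `ψ`. [cite: Lapierre2021, Ch. 7 §7.7 eq. (7.24); Ch. 2 §2.13 eq. (2.46)] -/
def expect (A : Matrix Bool Bool ℂ) (ψ : Bool → ℂ) : ℂ := star ψ ⬝ᵥ (A *ᵥ ψ)

/-- Entries of `|0⟩ = (1, 0)ᵀ`. [cite: Lapierre2021, Ch. 7 §7.5 eq. (7.8)] -/
@[simp] theorem ket0_apply (a : Bool) : ket0 a = if a then 0 else 1 := rfl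

/-- Entries of `R_y(θ)` as printed in (14.3). [cite: Lapierre2021, Ch. 14 §14.1 eq. (14.3)] -/
@[simp] theorem rotY_apply (θ : ℝ) (a b : Bool) :
    rotY θ a b =
      if a = b then (Real.cos (θ / 2) : ℂ) else if a then (Real.sin (θ / 2) : ℂ) else -(Real.sin (θ / 2) : ℂ) := rfl

/-- Entries of `R_x(θ)` as printed in (14.2). [cite: Lapierre2021, Ch. 14 §14.1 eq. (14.2)] -/
@[simp] theorem rotX_apply (θ : ℝ) (a b : Bool) :
    rotX θ a b = if a = b then (Real.cos (θ / 2) : ℂ) else ⟨0, -Real.sin (θ / 2)⟩ := rfl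

/-- Entries of `H = (1/√2)·[[1, 1], [1, −1]]` as printed in (7.35). [cite: Lapierre2021, Ch. 7 §7.13 eq. (7.35)] -/
@[simp] theorem hadamard_apply (a b : Bool) :
    hadamard a b = if a = true ∧ b = true then -(((Real.sqrt 2)⁻¹ : ℝ) : ℂ) else (((Real.sqrt 2)⁻¹ : ℝ) : ℂ) := rfl

/-- The expectation value over the two basis states, unfolded (plumbing). [folklore] -/
private theorem expect_eq (A : Matrix Bool Bool ℂ) (ψ : Bool → ℂ) :
    expect A ψ = star (ψ false) * (A false false * ψ false + A false true * ψ true)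
      + star (ψ true) * (A true false * ψ false + A true true * ψ true) := by
  simp only [expect, dotProduct, mulVec, Fintype.sum_bool, Pi.star_apply]
  ring

/-- Matrix–vector product over `Bool`, unfolded (plumbing; the pattern of eq. (7.8)). [folklore] -/
private theorem mulVec_apply_bool (A : Matrix Bool Bool ℂ) (v : Bool → ℂ) (a : Bool) :
    (A *ᵥ v) a = A a false * v false + A a true * v true := by
  simp only [mulVec, dotProduct, Fintype.sum_bool]; ring

/-- Double-angle identity `cos θ = 2cos²(θ/2) − 1`. [folklore] -/
private theorem cos_eq (θ : ℝ) : Real.cos θ = 2 * Real.cos (θ / 2) ^ 2 - 1 := by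
  have h := Real.cos_two_mul (θ / 2); rwa [show 2 * (θ / 2) = θ by ring] at h

/-- Double-angle identity `sin θ = 2 sin(θ/2) cos(θ/2)`. [folklore] -/
private theorem sin_eq (θ : ℝ) : Real.sin θ = 2 * Real.sin (θ / 2) * Real.cos (θ / 2) := by
  have h := Real.sin_two_mul (θ / 2); rwa [show 2 * (θ / 2) = θ by ring] at h

/-- `(√2)² = 2`. [folklore] -/
private theorem sqrt_two_sq : Real.sqrt 2 ^ 2 = 2 := Real.sq_sqrt (by norm_num : (0 : ℝ) ≤ 2)

/-! ### Pauli form and unitarity (eqs. (14.5)–(14.6), Exercise 14.2) -/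

/-- `R_y(θ) = cos(θ/2)·I − i sin(θ/2)·σ_y`. [cite: Lapierre2021, Ch. 14 §14.1 eq. (14.6)] -/
theorem rotY_eq_pauli (θ : ℝ) :
    rotY θ = (Real.cos (θ / 2) : ℂ) • (1 : Matrix Bool Bool ℂ) - (Complex.I * (Real.sin (θ / 2) : ℂ)) • mat Y := by
  ext a b
  apply Complex.ext <;> cases a <;> cases b <;>
    simp [-Complex.ofReal_cos, -Complex.ofReal_sin]

/-- `R_x(θ) = cos(θ/2)·I − i sin(θ/2)·σ_x`. [cite: Lapierre2021, Ch. 14 §14.1 eq. (14.5)] -/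
theorem rotX_eq_pauli (θ : ℝ) :
    rotX θ = (Real.cos (θ / 2) : ℂ) • (1 : Matrix Bool Bool ℂ) - (Complex.I * (Real.sin (θ / 2) : ℂ)) • mat X := by
  ext a b
  apply Complex.ext <;> cases a <;> cases b <;>
    simp [-Complex.ofReal_cos, -Complex.ofReal_sin]

/-- `R_y(θ)` is unitary: `R_y(θ)ᴴ R_y(θ) = 1` (Exercise 14.2). [cite: Lapierre2021, Ch. 14 §14.1 Exercise 14.2] -/
theorem conjTranspose_rotY_mul_self (θ : ℝ) : (rotY θ)ᴴ * rotY θ = 1 := by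
  have hp := Real.cos_sq_add_sin_sq (θ / 2)
  ext a b
  apply Complex.ext <;> cases a <;> cases b <;>
    simp [mul_apply_bool, Matrix.conjTranspose_apply, -Complex.ofReal_cos, -Complex.ofReal_sin] <;>
    first | linear_combination hp | ring1

/-- `R_x(θ)` is unitary: `R_x(θ)ᴴ R_x(θ) = 1` (Exercise 14.2). [cite: Lapierre2021, Ch. 14 §14.1 Exercise 14.2] -/
theorem conjTranspose_rotX_mul_self (θ : ℝ) : (rotX θ)ᴴ * rotX θ = 1 := by
  have hp := Real.cos_sq_add_sin_sq (θ / 2)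
  ext a b
  apply Complex.ext <;> cases a <;> cases b <;>
    simp [mul_apply_bool, Matrix.conjTranspose_apply, -Complex.ofReal_cos, -Complex.ofReal_sin] <;>
    first | linear_combination hp | ring1

/-- The Hadamard gate is unitary, `Hᴴ H = 1` (Exercise 7.5 "Show that H is unitary"). [cite: Lapierre2021, Ch. 7 §7.13 Exercise 7.5] -/
theorem conjTranspose_hadamard_mul_self : hadamardᴴ * hadamard = 1 := by
  have h2 := sqrt_two_sq
  ext a b
  apply Complex.ext <;> cases a <;> cases b <;>
    simp [mul_apply_bool, Matrix.conjTranspose_apply] <;>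
    linear_combination (1 / 2 : ℝ) * h2

/-! ### The state `R_y(θ)|0⟩` and its Bloch vector `(sin θ, 0, cos θ)` (Exercise 14.1 about the `y` axis) -/

/-- `R_y(θ)|0⟩ = cos(θ/2)|0⟩ + sin(θ/2)|1⟩` — the Bloch form (14.1) with polar angle `θ` and `φ = 0`.
[cite: Lapierre2021, Ch. 14 §14.1 eq. (14.1), (14.3)] -/
theorem rotY_mulVec_ket0 (θ : ℝ) :
    rotY θ *ᵥ ket0 = fun a => if a then (Real.sin (θ / 2) : ℂ) else (Real.cos (θ / 2) : ℂ) := by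
  funext a
  cases a <;> simp [mulVec_apply_bool, -Complex.ofReal_cos, -Complex.ofReal_sin]

/-- `⟨Z⟩ = cos θ` in the state `R_y(θ)|0⟩` (the `z` component of a Bloch vector rotated by `θ` about `y`).
[cite: Lapierre2021, Ch. 14 §14.1 Exercise 14.1] -/
theorem expect_Z_rotY_ket0 (θ : ℝ) : expect (mat Z) (rotY θ *ᵥ ket0) = (Real.cos θ : ℂ) := by
  have hp := Real.cos_sq_add_sin_sq (θ / 2)
  rw [expect_eq, mulVec_apply_bool, mulVec_apply_bool]
  apply Complex.ext
  · simp [-Complex.ofReal_cos, -Complex.ofReal_sin]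
    rw [cos_eq θ]
    linear_combination -hp
  · simp [-Complex.ofReal_cos, -Complex.ofReal_sin]

/-- `⟨X⟩ = sin θ` in the state `R_y(θ)|0⟩`. [cite: Lapierre2021, Ch. 14 §14.1 Exercise 14.1] -/
theorem expect_X_rotY_ket0 (θ : ℝ) : expect (mat X) (rotY θ *ᵥ ket0) = (Real.sin θ : ℂ) := by
  rw [expect_eq, mulVec_apply_bool, mulVec_apply_bool]
  apply Complex.ext
  · simp [-Complex.ofReal_cos, -Complex.ofReal_sin]
    rw [sin_eq θ]
    ring
  · simp [-Complex.ofReal_cos, -Complex.ofReal_sin]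

/-- `⟨Y⟩ = 0` in the state `R_y(θ)|0⟩` (the state stays in the `x–z` plane). [cite: Lapierre2021, Ch. 14 §14.1 Exercise 14.1] -/
theorem expect_Y_rotY_ket0 (θ : ℝ) : expect (mat Y) (rotY θ *ᵥ ket0) = 0 := by
  rw [expect_eq, mulVec_apply_bool, mulVec_apply_bool]
  apply Complex.ext
  · simp [-Complex.ofReal_cos, -Complex.ofReal_sin]
  · simp [-Complex.ofReal_cos, -Complex.ofReal_sin]
    ring

/-! ### `H` then `R_y(θ)`: `⟨Z⟩ = −sin θ` -/

/-- `H|0⟩ = (|0⟩ + |1⟩)/√2 = |+⟩`. [cite: Lapierre2021, Ch. 7 §7.13 eq. (7.34)] -/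
theorem hadamard_mulVec_ket0 : hadamard *ᵥ ket0 = fun _ => (((Real.sqrt 2)⁻¹ : ℝ) : ℂ) := by
  funext a
  cases a <;> simp [mulVec_apply_bool]

/-- In the state `R_y(θ) H |0⟩` (Hadamard, then a trainable `R_y` — the per-wire circuit of the lane's product-layer
certificate) the `Z` expectation is `⟨Z⟩ = −sin θ`: the Bloch vector `(1, 0, 0)` rotated by `θ` about `y`.
[cite: Lapierre2021, Ch. 14 §14.1 Exercise 14.1] -/
theorem expect_Z_rotY_hadamard_ket0 (θ : ℝ) :
    expect (mat Z) (rotY θ *ᵥ (hadamard *ᵥ ket0)) = -(Real.sin θ : ℂ) := by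
  have h2 := sqrt_two_sq
  rw [hadamard_mulVec_ket0, expect_eq, mulVec_apply_bool, mulVec_apply_bool]
  apply Complex.ext
  · simp [-Complex.ofReal_cos, -Complex.ofReal_sin]
    rw [sin_eq θ]
    linear_combination (-(Real.cos (θ / 2) * Real.sin (θ / 2))) * h2
  · simp [-Complex.ofReal_cos, -Complex.ofReal_sin]

/-! ### The two-angle ansatz `R_x(φ) R_y(θ) |0⟩`: Bloch vector `(sin θ, −cos θ sin φ, cos θ cos φ)` -/

/-- `⟨Z⟩ = cos θ · cos φ` in the state `R_x(φ) R_y(θ) |0⟩` (rotation by `θ` about `y`, then by `φ` about `x`).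
[cite: Lapierre2021, Ch. 14 §14.1 Exercise 14.1] -/
theorem expect_Z_rotX_rotY_ket0 (θ φ : ℝ) :
    expect (mat Z) (rotX φ *ᵥ (rotY θ *ᵥ ket0)) = (Real.cos θ : ℂ) * (Real.cos φ : ℂ) := by
  have hp := Real.cos_sq_add_sin_sq (θ / 2)
  have hq := Real.cos_sq_add_sin_sq (φ / 2)
  rw [rotY_mulVec_ket0, expect_eq, mulVec_apply_bool, mulVec_apply_bool]
  apply Complex.ext
  · simp [-Complex.ofReal_cos, -Complex.ofReal_sin]
    rw [cos_eq θ, cos_eq φ]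
    linear_combination (-(Real.cos (θ / 2) ^ 2 - Real.sin (θ / 2) ^ 2)) * hq
      - (2 * Real.cos (φ / 2) ^ 2 - 1) * hp
  · simp [-Complex.ofReal_cos, -Complex.ofReal_sin]
    ring

/-- `⟨Y⟩ = −cos θ · sin φ` in the state `R_x(φ) R_y(θ) |0⟩`. [cite: Lapierre2021, Ch. 14 §14.1 Exercise 14.1] -/
theorem expect_Y_rotX_rotY_ket0 (θ φ : ℝ) :
    expect (mat Y) (rotX φ *ᵥ (rotY θ *ᵥ ket0)) = -((Real.cos θ : ℂ) * (Real.sin φ : ℂ)) := by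
  have hp := Real.cos_sq_add_sin_sq (θ / 2)
  rw [rotY_mulVec_ket0, expect_eq, mulVec_apply_bool, mulVec_apply_bool]
  apply Complex.ext
  · simp [-Complex.ofReal_cos, -Complex.ofReal_sin]
    rw [cos_eq θ, sin_eq φ]
    linear_combination (2 * Real.cos (φ / 2) * Real.sin (φ / 2)) * hp
  · simp [-Complex.ofReal_cos, -Complex.ofReal_sin]
    ring

/-- `⟨X⟩ = sin θ` in the state `R_x(φ) R_y(θ) |0⟩` (the `x` component is fixed by a rotation about `x`).
[cite: Lapierre2021, Ch. 14 §14.1 Exercise 14.1] -/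
theorem expect_X_rotX_rotY_ket0 (θ φ : ℝ) :
    expect (mat X) (rotX φ *ᵥ (rotY θ *ᵥ ket0)) = (Real.sin θ : ℂ) := by
  have hq := Real.cos_sq_add_sin_sq (φ / 2)
  rw [rotY_mulVec_ket0, expect_eq, mulVec_apply_bool, mulVec_apply_bool]
  apply Complex.ext
  · simp [-Complex.ofReal_cos, -Complex.ofReal_sin]
    rw [sin_eq θ]
    linear_combination (2 * Real.cos (θ / 2) * Real.sin (θ / 2)) * hq
  · simp [-Complex.ofReal_cos, -Complex.ofReal_sin]
    ring

end Literature.Computability.QuantumComplexity.SingleQubitRotations
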